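import Summits.AnomalousDissipation.AnomalousDissipation.Theses.BaireTransfer
import Literature.Analysis.FluidPDE.LinearizedNSTorus

/-!
# Vocabulary of the crux `BaireTransfer.RobustLoudUpgrade` (stmt-AnomalousDissipation-1144) and of its line
`malkin-cone-group-orbits` (lead's reshaped skeleton v2)

Definitions-only support file (plus the definitional `crux_iff`), so that the line's REGISTERED STUBS — which
are landed one by one as `--supports stmt-AnomalousDissipation-1144` files under `Theorems/` — and the lead's
skeleton (`Cruxes/RobustLoudUpgrade/Lines/malkin-cone-group-orbits.lean`, not importable) speak about the SAME
declarations: the parameter space `Coeff S`, the steady trigonometric-polynomial force `force S c` (verbatim the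
route file's `realTrigPoly S (k ↦ lerayCoeff k (coeffExt S c k))`), the loud sets `loud S a E ε` (the route's
`LOUD_j` is the ceiling `a = 1/(j+1)`), and the witness classes of the line: `nondegSteady` (mean-zero steady
witness with strict budgets and no classical kernel of the linearisation in the mean-zero class —
`Literature.Analysis.FluidPDE.Torus.IsLinNSEigenvalue`), `persistSteady` / `SteadyPersistsAt` / `h1DistSq` (the
conclusion of the steady implicit-function theorem stated without function spaces: steady states persist
`H¹`-continuously under small changes of the force at fixed viscosity), `censusSteady` (at one viscosity every
mean-zero classical steady state has strict budgets — nondegeneracy-free), `malkinSteady` (Goldstone-degenerate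
steady circle of a lattice-invariant force with one first-order-visible symmetry-breaking mode; `idot`,
`invariantAlong`, `breakingAlong`, `cplx`, `goldstone`), `nondegPeriodic` (periodic witness with simple Floquet
multiplier `1`, through the classical linearised periodic problem `linPeriodicSol`, `velocityDot`), their union
`tame`, and the stock `unitStock = {k : |k|∞ ≤ 1}`.

All notions are those of the planner's checked skeleton (crux-plan round 1, triaged ×3) except: every steady
witness is MEAN ZERO (the conserved-mean leaf; triage F1/X2), and `censusSteady`, `persistSteady`,
`SteadyPersistsAt`, `h1DistSq` are the lead's additions (reshape v2, 2026-08-16).  No facts are asserted here.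

References: Temam, *Navier–Stokes Equations* (1979) Ch. II §1 (steady states); Henry, *Geometric Theory of
Semilinear Parabolic Equations* (1981) Ch. 8; Vanderbauwhede, *Local Bifurcation and Symmetry* (1982) Ch. 8;
Constantin–Foias (1988) Ch. 7 (linearisation); the route file `Theses/BaireTransfer.lean` (item 1144).
-/

-- `Summit.<Summit>.<Problem>` is the tree's mandated summit-side namespace (CONVENTIONS §2); for this
-- single-conjunct summit the two coincide, so the duplicate is deliberate.
set_option linter.dupNamespace false

noncomputable section

open scoped BigOperators Topology
open Filter Set Function TopologicalSpace MeasureTheory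

namespace Summit.AnomalousDissipation.AnomalousDissipation.Theorems.RobustLoudUpgrade

open Literature.Analysis.FunctionSpaces Literature.Analysis.FunctionSpaces.Torus
open Literature.Analysis.FluidPDE
open Summit.AnomalousDissipation.AnomalousDissipation.Theses.BaireTransfer

/-- The flat unit torus `T³`. -/
local notation "𝕋³" => UnitAddTorus (Fin 3)
/-- Real velocity values. -/
local notation "ℝ³" => EuclideanSpace ℝ (Fin 3)
/-- Complex Fourier coefficients / complexified velocity values. -/
local notation "ℂ³" => EuclideanSpace ℂ (Fin 3)

/-! ## §0 The crux's vocabulary -/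

/-- The parameter space `P_S = (↥S → ℂ³)` of coefficient vectors (sup norm; finite dimensional, complete, hence
Baire). [folklore] -/
abbrev Coeff (S : Finset (Fin 3 → ℤ)) : Type := ↥S → ℂ³

/-- The steady trigonometric-polynomial force `f_c = realTrigPoly S (k ↦ P_k ĉ_k)` parametrised by `c ∈ P_S`
(verbatim the force of the route file `Theses/BaireTransfer.lean`). [folklore] -/
def force (S : Finset (Fin 3 → ℤ)) (c : Coeff S) : 𝕋³ → ℝ³ :=
  realTrigPoly S (fun k => Torus.lerayCoeff k (coeffExt S c k))

/-- `LOUD^{(0,a)}(S,E,ε)`: coefficient vectors `c` carrying, at SOME viscosity `ν ∈ (0,a)`, a time-periodic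
classical solution of NS_ν on `ℝ × T³` forced by `f_c` with mean energy `≤ E` and mean dissipation `≥ ε`
(the route's `LOUD_j` is the ceiling `a = 1/(j+1)`). [folklore] -/
def loud (S : Finset (Fin 3 → ℤ)) (a E ε : ℝ) : Set (Coeff S) :=
  {c | ∃ ν : ℝ, 0 < ν ∧ ν < a ∧ ∃ (τ : ℝ) (u : ℝ → 𝕋³ → ℝ³) (p : ℝ → 𝕋³ → ℝ), 0 < τ ∧
    IsClassicalNSSolutionOn Set.univ ν (fun _ => force S c) u p ∧ Function.Periodic u τ ∧
      meanEnergy u ≤ E ∧ ε ≤ meanDissipation ν u}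

/-- **The crux, restated** (definitional): `RobustLoudUpgrade ↔ ∃ S₀ ∀ S ⊇ S₀ ∀ E ε, 0 < ε → ∀ j,
LOUD_j(S,E,ε) ⊆ closure (interior LOUD_j(S,2E,ε/2))`. [folklore] -/
theorem crux_iff :
    RobustLoudUpgrade ↔
      ∃ S₀ : Finset (Fin 3 → ℤ), ∀ S : Finset (Fin 3 → ℤ), S₀ ⊆ S → ∀ (E ε : ℝ), 0 < ε →
        ∀ j : ℕ, loud S (1 / ((j : ℝ) + 1)) E ε ⊆
          closure (interior (loud S (1 / ((j : ℝ) + 1)) (2 * E) (ε / 2))) :=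
  Iff.rfl

/-- The stock of the line: the unit cube of frequencies `{k : |k|∞ ≤ 1}` (it contains, for every non-trivial
translation `t ∈ T³`, a mode `eᵢ` with `eᵢ·t ∉ ℤ`, i.e. it breaks every continuous isotropy). [folklore] -/
def unitStock : Finset (Fin 3 → ℤ) := Finset.Icc (-1) 1

/-! ## §1 Steady witnesses: persistence, nondegeneracy, census -/

/-- Squared `H¹` distance of two velocity fields: `∫‖u − v‖² + ‖∇(u − v)‖₂²` (pointwise gradients,
`Torus.gradNormSq`; meaningful for `C¹` fields, which is how it is used). [folklore] -/
def h1DistSq (u v : 𝕋³ → ℝ³) : ℝ :=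
  (∫ x, ‖u x - v x‖ ^ 2) + gradNormSq (fun x => u x - v x)

/-- **Persistence of a steady state under change of the force, at FIXED viscosity**: for every `δ > 0` all
forces `f_{c'}` with `c'` in some ball around `c` carry a mean-zero classical steady state `u'` of `NS_ν` within
squared `H¹`-distance `δ` of `u₀`.  (The conclusion of the steady implicit-function theorem — Temam 1979 Ch. II,
Foias–Temam 1977, Saut–Temam 1980 — stated without function spaces.) [folklore] -/
@[folklore] def SteadyPersistsAt (S : Finset (Fin 3 → ℤ)) (c : Coeff S) (ν : ℝ) (u₀ : 𝕋³ → ℝ³) : Prop :=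
  ∀ δ : ℝ, 0 < δ → ∃ r : ℝ, 0 < r ∧ ∀ c' : Coeff S, dist c' c < r →
    ∃ (u' : 𝕋³ → ℝ³) (p' : 𝕋³ → ℝ), Torus.IsSteadyNSState ν (force S c') u' p' ∧ HasZeroMean u' ∧
      h1DistSq u' u₀ < δ

/-- **Nondegenerate mean-zero loud steady witnesses.** `c` carries, at some `ν ∈ (0,a)`, a smooth mean-zero
steady state `u₀` of `NS_ν(f_c)` with `meanEnergy < E`, `meanDissipation > ε`, whose linearisation has NO
eigenvalue `0` in the mean-zero class (`Torus.IsLinNSEigenvalue`, classical point spectrum). [folklore] -/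
def nondegSteady (S : Finset (Fin 3 → ℤ)) (a E ε : ℝ) : Set (Coeff S) :=
  {c | ∃ ν : ℝ, 0 < ν ∧ ν < a ∧ ∃ (u₀ : 𝕋³ → ℝ³) (p₀ : 𝕋³ → ℝ),
    Torus.IsSteadyNSState ν (force S c) u₀ p₀ ∧ HasZeroMean u₀ ∧ meanEnergy (fun _ : ℝ => u₀) < E ∧
      ε < meanDissipation ν (fun _ : ℝ => u₀) ∧ ¬ Torus.IsLinNSEigenvalue ν u₀ 0}

/-- **Persistent loud steady witnesses** (the interface between the two halves of the steady IFT): a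
mean-zero steady witness with strict budgets that persists `H¹`-continuously under small changes of the
force at the same viscosity. [folklore] -/
def persistSteady (S : Finset (Fin 3 → ℤ)) (a E ε : ℝ) : Set (Coeff S) :=
  {c | ∃ ν : ℝ, 0 < ν ∧ ν < a ∧ ∃ (u₀ : 𝕋³ → ℝ³) (p₀ : 𝕋³ → ℝ),
    Torus.IsSteadyNSState ν (force S c) u₀ p₀ ∧ HasZeroMean u₀ ∧ meanEnergy (fun _ : ℝ => u₀) < E ∧
      ε < meanDissipation ν (fun _ : ℝ => u₀) ∧ SteadyPersistsAt S c ν u₀}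

/-- **Window census (nondegeneracy-free).** At some `ν ∈ (0,a)` EVERY mean-zero classical steady state of
`NS_ν(f_c)` has strict budgets `meanEnergy < E`, `meanDissipation > ε`.  (Non-vacuous: steady states exist for
every force at every `ν > 0`, Temam 1979 Ch. II Thm 1.2, in tree as
`Literature.Analysis.FluidPDE.Torus.Temam1979_exists_steadyWeakSolution_holds`.) [folklore] -/
def censusSteady (S : Finset (Fin 3 → ℤ)) (a E ε : ℝ) : Set (Coeff S) :=
  {c | ∃ ν : ℝ, 0 < ν ∧ ν < a ∧ ∀ (u₀ : 𝕋³ → ℝ³) (p₀ : 𝕋³ → ℝ),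
    Torus.IsSteadyNSState ν (force S c) u₀ p₀ → HasZeroMean u₀ →
      meanEnergy (fun _ : ℝ => u₀) < E ∧ ε < meanDissipation ν (fun _ : ℝ => u₀)}

/-! ## §2 Symmetric steady witnesses: the Malkin class -/

/-- Integer pairing `k·a`. [folklore] -/
def idot (k a : Fin 3 → ℤ) : ℤ := ∑ i, k i * a i

/-- The `a`-INVARIANT coefficient vectors: every active mode is orthogonal to `a`, so that
`f_c(x + t a) = f_c(x)` for all `t` (sufficient coefficient test). [folklore] -/
def invariantAlong (S : Finset (Fin 3 → ℤ)) (a : Fin 3 → ℤ) : Set (Coeff S) :=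
  {c | ∀ k : ↥S, c k ≠ 0 → idot k a = 0}

/-- The symmetry-BREAKING coefficient vectors: supported on modes with `k·a ≠ 0`, so that the Malkin function
`θ ↦ ⟨ψ_θ, f_d⟩ = ∑ₖ ⟨ψ̂₀(k), f̂_d(k)⟩ e^{2πiθ k·a}` has ZERO `θ`-mean. [folklore] -/
def breakingAlong (S : Finset (Fin 3 → ℤ)) (a : Fin 3 → ℤ) : Set (Coeff S) :=
  {d | ∀ k : ↥S, idot k a = 0 → d k = 0}

/-- Complexification of a real field on `T³`. [folklore] -/
def cplx (v : 𝕋³ → ℝ³) : 𝕋³ → ℂ³ := fun x => Torus.realToComplex (v x)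

/-- The Goldstone mode `∂ₐu₀ = ∑ᵢ aᵢ ∂ᵢu₀` (complexified): the symmetry generator, always in the kernel of the
linearisation at a steady state `u₀` of an `a`-invariant force. [folklore] -/
def goldstone (a : Fin 3 → ℤ) (u₀ : 𝕋³ → ℝ³) : 𝕋³ → ℂ³ :=
  fun x => Torus.realToComplex (∑ i, (a i : ℝ) • partialDeriv i u₀ x)

/-- **Malkin-visible Goldstone steady witnesses.** `f_c` is invariant along a lattice direction `a ≠ 0`; the
mean-zero loud steady witness `u₀` has mean-zero kernel EXACTLY `ℂ·∂ₐu₀` (normal nondegeneracy of the circle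
`K·u₀` of steady states — no spectral gap, no hyperbolicity asked); and ONE symmetry-breaking `d ∈ P_S` is
first-order VISIBLE: `f_d ∉ range L(ν,u₀)` (Fredholm alternative: `M_d(0) = ⟨ψ₀, f_d⟩ ≠ 0`).
(Vanderbauwhede 1982 Thm 8.2.11; Dancer 1984.) [folklore] -/
def malkinSteady (S : Finset (Fin 3 → ℤ)) (a E ε : ℝ) : Set (Coeff S) :=
  {c | ∃ ν : ℝ, 0 < ν ∧ ν < a ∧ ∃ (u₀ : 𝕋³ → ℝ³) (p₀ : 𝕋³ → ℝ),
    Torus.IsSteadyNSState ν (force S c) u₀ p₀ ∧ HasZeroMean u₀ ∧ meanEnergy (fun _ : ℝ => u₀) < E ∧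
      ε < meanDissipation ν (fun _ : ℝ => u₀) ∧
      ∃ dir : Fin 3 → ℤ, dir ≠ 0 ∧ c ∈ invariantAlong S dir ∧
        (∀ w, Torus.LinNSResolventRel ν u₀ 0 w 0 → ∃ z : ℂ, w = z • goldstone dir u₀) ∧
        ∃ d : Coeff S, d ∈ breakingAlong S dir ∧ ∀ w, ¬ Torus.LinNSResolventRel ν u₀ 0 w (cplx (force S d))}

/-! ## §3 Periodic witnesses: the linearised periodic problem and nondegeneracy -/

/-- **Solutions of the linearised periodic problem** `(∂ₜ − L(ν, u(t))) w = g` along a time-dependent state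
`u`, classically: `w` jointly smooth, divergence free, mean zero (the conserved-mean leaf), `τ`-periodic, with a
smooth pressure `q`.  With `g = 0` its solutions are the eigenvectors of the period map for the Floquet
multiplier `1`; with `g = ∂ₜu` a solution is a Jordan partner of `∂ₜu` (so "no solution" = algebraic
simplicity).  Equation-level substitute for the missing period-map notion, over the accepted
`Torus.linearizedNSOperator`. (Henry 1981 Ch. 8.) [folklore] -/
def linPeriodicSol (ν : ℝ) (u : ℝ → 𝕋³ → ℝ³) (τ : ℝ) (g : ℝ → 𝕋³ → ℂ³) : Set (ℝ → 𝕋³ → ℂ³) :=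
  {w | IsSmoothSpaceTimeOn Set.univ w ∧ (∀ t, Torus.IsDivFreeC (w t)) ∧ (∀ t, HasZeroMean (w t)) ∧
    Function.Periodic w τ ∧
      ∃ q : ℝ → 𝕋³ → ℂ, IsSmoothSpaceTimeOn Set.univ q ∧
        ∀ t x, Torus.timeDerivWithin Set.univ w t x =
          Torus.linearizedNSOperator ν (u t) (w t) (q t) x + g t x}

/-- `∂ₜu`, complexified. [folklore] -/
def velocityDot (u : ℝ → 𝕋³ → ℝ³) : ℝ → 𝕋³ → ℂ³ :=
  fun t x => Torus.realToComplex (Torus.timeDerivWithin Set.univ u t x)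

/-- **Nondegenerate loud periodic witnesses** (simple Floquet multiplier `1`, no period map needed): the
`τ`-periodic solutions of the linearised problem are the multiples of `∂ₜu`, and `∂ₜu` has no `τ`-periodic
Jordan partner. [folklore] -/
def nondegPeriodic (S : Finset (Fin 3 → ℤ)) (a E ε : ℝ) : Set (Coeff S) :=
  {c | ∃ ν : ℝ, 0 < ν ∧ ν < a ∧ ∃ (τ : ℝ) (u : ℝ → 𝕋³ → ℝ³) (p : ℝ → 𝕋³ → ℝ), 0 < τ ∧
    IsClassicalNSSolutionOn Set.univ ν (fun _ => force S c) u p ∧ Function.Periodic u τ ∧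
      meanEnergy u < E ∧ ε < meanDissipation ν u ∧
      (∀ w ∈ linPeriodicSol ν u τ 0, ∃ z : ℂ, w = z • velocityDot u) ∧
      linPeriodicSol ν u τ (velocityDot u) = ∅}

/-! ## §4 The tame union -/

/-- The TAME union of the line `malkin-cone-group-orbits` (lead's reshape v2) at budgets `(E, ε)`:
nondegenerate steady ∪ window census ∪ Malkin-visible steady circle ∪ nondegenerate periodic. [folklore] -/
def tame (S : Finset (Fin 3 → ℤ)) (a E ε : ℝ) : Set (Coeff S) :=
  nondegSteady S a E ε ∪ censusSteady S a E ε ∪ malkinSteady S a E ε ∪ nondegPeriodic S a E ε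


/-! ## §5 Engine and composition (sorry-free): how the line's six registered stubs close the crux BY NAME

The registered stubs of the line (lead's skeleton v2, `ledger skeleton check` 2026-08-16) are exactly the six
hypotheses of `RobustLoudUpgrade_of` below, each to be landed as its own `--supports` file:
`stub_steadyPersist : ∀ S a E ε, nondegSteady S a E ε ⊆ persistSteady S a E ε`,
`stub_steadyWindow : ∀ S a E ε, persistSteady S a E ε ⊆ interior (loud S a E ε)`,
`stub_censusInterior : ∀ S a E ε, censusSteady S a E ε ⊆ interior (loud S a E ε)`,
`stub_malkinConeSteady : ∀ S a E ε, malkinSteady S a E ε ⊆ closure (interior (loud S a E ε))`,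
`stub_periodicIFT : ∀ S a E ε, nondegPeriodic S a E ε ⊆ interior (loud S a E ε)`,
`stub_tameDense : ∀ S ⊇ unitStock, ∀ a E ε, 0 < a → 0 < ε → loud S a E ε ⊆ closure (tame S a (2E) (ε/2))`. -/

/-- **Cone engine** (pure topology): if for all `0 < s < s₀` and all `d'` in a fixed ball around `d` the point
`c₀ + s • d'` is good, then `c₀ ∈ closure (interior GOOD)` — the last step of the Malkin stub (the truncated open
cone of forces with a persisted zero of the reduced equation). [folklore] -/
theorem mem_closure_interior_of_cone {V : Type*} [NormedAddCommGroup V] [NormedSpace ℝ V]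
    {A : Set V} {c₀ d : V} {r s₀ : ℝ} (hr : 0 < r) (hs₀ : 0 < s₀)
    (h : ∀ s : ℝ, 0 < s → s < s₀ → ∀ d' : V, dist d' d < r → c₀ + s • d' ∈ A) :
    c₀ ∈ closure (interior A) := by
  rw [Metric.mem_closure_iff]
  intro δ hδ
  -- pick a small positive `s` with `s < s₀` and `s * ‖d‖ < δ`
  obtain ⟨s, hs0, hs1, hs2⟩ : ∃ s : ℝ, 0 < s ∧ s < s₀ ∧ s * ‖d‖ < δ := by
    refine ⟨min (s₀ / 2) (δ / (2 * (‖d‖ + 1))), ?_, ?_, ?_⟩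
    · positivity
    · exact (min_le_left _ _).trans_lt (by linarith)
    · have hd : 0 ≤ ‖d‖ := norm_nonneg d
      have h1 : min (s₀ / 2) (δ / (2 * (‖d‖ + 1))) ≤ δ / (2 * (‖d‖ + 1)) := min_le_right _ _
      calc min (s₀ / 2) (δ / (2 * (‖d‖ + 1))) * ‖d‖
          ≤ δ / (2 * (‖d‖ + 1)) * ‖d‖ := mul_le_mul_of_nonneg_right h1 hd
        _ < δ := by
            rw [div_mul_eq_mul_div, div_lt_iff₀ (by positivity)]
            nlinarith
  refine ⟨c₀ + s • d, ?_, ?_⟩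
  · -- the open set `c₀ + s • ball d r` lies in `A`, hence in `interior A`
    have hopen : IsOpen ((fun d' => c₀ + s • d') '' Metric.ball d r) := by
      have e : (fun d' : V => c₀ + s • d') = (fun x => c₀ + x) ∘ (fun d' => s • d') := rfl
      rw [e, Set.image_comp]
      exact (isOpenMap_add_left c₀) _ ((isOpenMap_smul₀ hs0.ne') _ Metric.isOpen_ball)
    have hsub : (fun d' => c₀ + s • d') '' Metric.ball d r ⊆ A := by
      rintro _ ⟨d', hd', rfl⟩
      exact h s hs0 hs1 d' (Metric.mem_ball.1 hd')
    exact interior_maximal hsub hopen ⟨d, Metric.mem_ball_self hr, rfl⟩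
  · -- and `c₀ + s • d` is `δ`-close to `c₀`
    rw [dist_eq_norm, sub_add_cancel_left, norm_neg, norm_smul, Real.norm_of_nonneg hs0.le]
    exact hs2

/-- The tame union lies in `closure (interior LOUD)` at the same (strict) budgets, given the five upgrade
stubs. [folklore] -/
theorem tame_subset_closure_interior
    (h₁ : ∀ (S : Finset (Fin 3 → ℤ)) (a E ε : ℝ), nondegSteady S a E ε ⊆ persistSteady S a E ε)
    (h₁' : ∀ (S : Finset (Fin 3 → ℤ)) (a E ε : ℝ), persistSteady S a E ε ⊆ interior (loud S a E ε))
    (h₀ : ∀ (S : Finset (Fin 3 → ℤ)) (a E ε : ℝ), censusSteady S a E ε ⊆ interior (loud S a E ε))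
    (h₂ : ∀ (S : Finset (Fin 3 → ℤ)) (a E ε : ℝ),
      malkinSteady S a E ε ⊆ closure (interior (loud S a E ε)))
    (h₃ : ∀ (S : Finset (Fin 3 → ℤ)) (a E ε : ℝ), nondegPeriodic S a E ε ⊆ interior (loud S a E ε))
    (S : Finset (Fin 3 → ℤ)) (a E ε : ℝ) :
    tame S a E ε ⊆ closure (interior (loud S a E ε)) := by
  refine Set.union_subset (Set.union_subset (Set.union_subset ?_ ?_) ?_) ?_
  · exact ((h₁ S a E ε).trans (h₁' S a E ε)).trans subset_closure
  · exact (h₀ S a E ε).trans subset_closure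
  · exact h₂ S a E ε
  · exact (h₃ S a E ε).trans subset_closure

/-- **Composition of the line (kernel-checked glue): the six registered stubs prove the crux BY NAME.**
`S₀ := unitStock`; for `c ∈ LOUD_j(S,E,ε)` the residual stub puts `c` in the closure of the tame union at budgets
`(2E, ε/2)`; the union lies in `closure (interior LOUD_j(S,2E,ε/2))` by the five upgrade stubs; `closure` is
monotone and idempotent.  (A CONDITIONAL result: its hypotheses are the line's registered stubs; it credits the
item only when all six have landed.) [folklore] -/
theorem RobustLoudUpgrade_of
    (h₁ : ∀ (S : Finset (Fin 3 → ℤ)) (a E ε : ℝ), nondegSteady S a E ε ⊆ persistSteady S a E ε)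
    (h₁' : ∀ (S : Finset (Fin 3 → ℤ)) (a E ε : ℝ), persistSteady S a E ε ⊆ interior (loud S a E ε))
    (h₀ : ∀ (S : Finset (Fin 3 → ℤ)) (a E ε : ℝ), censusSteady S a E ε ⊆ interior (loud S a E ε))
    (h₂ : ∀ (S : Finset (Fin 3 → ℤ)) (a E ε : ℝ),
      malkinSteady S a E ε ⊆ closure (interior (loud S a E ε)))
    (h₃ : ∀ (S : Finset (Fin 3 → ℤ)) (a E ε : ℝ), nondegPeriodic S a E ε ⊆ interior (loud S a E ε))
    (h₅ : ∀ S : Finset (Fin 3 → ℤ), unitStock ⊆ S → ∀ (a E ε : ℝ), 0 < a → 0 < ε →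
      loud S a E ε ⊆ closure (tame S a (2 * E) (ε / 2))) :
    RobustLoudUpgrade := by
  refine ⟨unitStock, fun S hS E ε hε j => ?_⟩
  have ha : (0 : ℝ) < 1 / ((j : ℝ) + 1) := by positivity
  intro c hc
  have hcl := h₅ S hS (1 / ((j : ℝ) + 1)) E ε ha hε hc
  have hsub := tame_subset_closure_interior h₁ h₁' h₀ h₂ h₃ S (1 / ((j : ℝ) + 1)) (2 * E) (ε / 2)
  exact closure_minimal hsub isClosed_closure hcl


/-- **Line glue, curried form** (the registered sub-goal `line_glue` of stmt-AnomalousDissipation-1144): the six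
registered stub statements imply the crux `RobustLoudUpgrade` (by `RobustLoudUpgrade_of`). [folklore] -/
theorem line_glue : (∀ (S : Finset (Fin 3 → ℤ)) (a E ε : ℝ), nondegSteady S a E ε ⊆ persistSteady S a E ε) → (∀ (S : Finset (Fin 3 → ℤ)) (a E ε : ℝ), persistSteady S a E ε ⊆ interior (loud S a E ε)) → (∀ (S : Finset (Fin 3 → ℤ)) (a E ε : ℝ), censusSteady S a E ε ⊆ interior (loud S a E ε)) → (∀ (S : Finset (Fin 3 → ℤ)) (a E ε : ℝ), malkinSteady S a E ε ⊆ closure (interior (loud S a E ε))) → (∀ (S : Finset (Fin 3 → ℤ)) (a E ε : ℝ), nondegPeriodic S a E ε ⊆ interior (loud S a E ε)) → (∀ S : Finset (Fin 3 → ℤ), unitStock ⊆ S → ∀ (a E ε : ℝ), 0 < a → 0 < ε → loud S a E ε ⊆ closure (tame S a (2 * E) (ε / 2))) → RobustLoudUpgrade :=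
  fun h₁ h₁' h₀ h₂ h₃ h₅ => RobustLoudUpgrade_of h₁ h₁' h₀ h₂ h₃ h₅

end Summit.AnomalousDissipation.AnomalousDissipation.Theorems.RobustLoudUpgrade

end

/-! ## §6 Reshape v3 (lead, 2026-08-16, after wave 1): two more witness classes

Wave 1 landed `stub_steadyPersist`, `stub_steadyWindow`, `stub_censusInterior` (Theorems/
`BaireTransferRobustLoudUpgradeStub{SteadyPersist,SteadyWindow,CensusInterior}.lean`, the steady layer resting on
`Literature/Analysis/FluidPDE/SteadyNSLatticePersistence.lean`).  The two remaining upgrade stubs are split along the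
seams their workers found:

* `stub_malkinConeSteady` = `stub_malkinBordered` (malkinSteady ⊆ borderedSteady: the BORDERED steady implicit
  function theorem at a Malkin-visible Goldstone state — one IFT for the steady map bordered by the visible breaking
  force `f_d` and a phase condition; analytic) ∘ `stub_borderedCone` (borderedSteady ⊆ closure (interior loud): pure
  finite-dimensional analysis on the `T³`-orbit + the cone engine; proved in the worker's file);
* `stub_periodicIFT` = `stub_periodicPersist` (nondegPeriodic ⊆ persistPeriodic: persistence of a nondegenerate
  periodic orbit under change of the force — Henry 1981 Ch. 8, the one published theorem the tree lacks) ∘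
  `stub_periodicWindow` (persistPeriodic ⊆ interior loud: period means move within the strict slack; proved).

The composition `RobustLoudUpgrade_of` above is fed with the two composites, so no new glue is needed. -/

namespace Summit.AnomalousDissipation.AnomalousDissipation.Theorems.RobustLoudUpgrade

open Literature.Analysis.FunctionSpaces Literature.Analysis.FunctionSpaces.Torus
open Literature.Analysis.FluidPDE
open Summit.AnomalousDissipation.AnomalousDissipation.Theses.BaireTransfer

/-- **Bordered steady persistence (the analytic interface of the Malkin lever).**  `c` is invariant along a lattice
direction `dir`, `d ∈ P_S` breaks `dir`, and there are a real-linear `ℓ : P_S → ℝ` with `ℓ d = 1`, a radius `r₀ > 0`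
and a real function `σ`, continuous on `ball c r₀`, vanishing at `c` with `Dσ(c) = ℓ`, such that at ONE viscosity
`ν ∈ (0,a)` every CORRECTED force `f_{c' − σ(c') d}`, `c' ∈ ball c r₀`, carries a classical steady state with budgets
`≤ E`, `≥ ε`.  (What the implicit function theorem for the steady Navier–Stokes map bordered by `f_d` and a phase
condition delivers at a Malkin-visible Goldstone steady state; Vanderbauwhede 1982 §8.5, Dancer 1984.) [folklore] -/
def borderedSteady (S : Finset (Fin 3 → ℤ)) (a E ε : ℝ) : Set (Coeff S) :=
  {c | ∃ ν : ℝ, 0 < ν ∧ ν < a ∧ ∃ (dir : Fin 3 → ℤ) (d : Coeff S) (ℓ : Coeff S →L[ℝ] ℝ)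
      (σ : Coeff S → ℝ) (r₀ : ℝ), c ∈ invariantAlong S dir ∧ d ∈ breakingAlong S dir ∧ ℓ d = 1 ∧
      σ c = 0 ∧ HasFDerivAt σ ℓ c ∧ 0 < r₀ ∧ ContinuousOn σ (Metric.ball c r₀) ∧
      ∀ c' ∈ Metric.ball c r₀, ∃ (u' : UnitAddTorus (Fin 3) → EuclideanSpace ℝ (Fin 3))
        (p' : UnitAddTorus (Fin 3) → ℝ),
        Torus.IsSteadyNSState ν (force S (c' - σ c' • d)) u' p' ∧
          meanEnergy (fun _ : ℝ => u') ≤ E ∧ ε ≤ meanDissipation ν (fun _ : ℝ => u')}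

/-- **Persistence of a periodic orbit under change of the force, at FIXED viscosity**: for every `δ > 0` all
forces `f_{c'}`, `c'` near `c`, carry a `τ'`-periodic classical solution of `NS_ν` on `ℝ × T³` whose orbit stays,
uniformly in time and after the linear time rescaling matching the periods, within `δ` of `u` in `L² ∩ Ḣ¹`
(the conclusion of Henry's persistence theorem, LNM 840 Ch. 8 §8.2–8.3, stated without function spaces).
[folklore] -/
@[folklore] def PeriodicPersistsAt (S : Finset (Fin 3 → ℤ)) (c : Coeff S) (ν τ : ℝ)
    (u : ℝ → UnitAddTorus (Fin 3) → EuclideanSpace ℝ (Fin 3)) : Prop :=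
  ∀ δ : ℝ, 0 < δ → ∃ r : ℝ, 0 < r ∧ ∀ c' : Coeff S, dist c' c < r →
    ∃ (τ' : ℝ) (u' : ℝ → UnitAddTorus (Fin 3) → EuclideanSpace ℝ (Fin 3)) (p' : ℝ → UnitAddTorus (Fin 3) → ℝ),
      0 < τ' ∧ IsClassicalNSSolutionOn Set.univ ν (fun _ => force S c') u' p' ∧ Function.Periodic u' τ' ∧
        ∀ t, (∫ x, ‖u' t x - u (τ / τ' * t) x‖ ^ 2) + gradNormSq (fun x => u' t x - u (τ / τ' * t) x) ≤ δ

/-- **Persistent loud periodic witnesses**: a `τ`-periodic classical witness with STRICT budgets that persists in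
the sense of `PeriodicPersistsAt` (the interface between Henry's theorem and the window argument). [folklore] -/
def persistPeriodic (S : Finset (Fin 3 → ℤ)) (a E ε : ℝ) : Set (Coeff S) :=
  {c | ∃ ν : ℝ, 0 < ν ∧ ν < a ∧ ∃ (τ : ℝ) (u : ℝ → UnitAddTorus (Fin 3) → EuclideanSpace ℝ (Fin 3))
      (p : ℝ → UnitAddTorus (Fin 3) → ℝ), 0 < τ ∧
    IsClassicalNSSolutionOn Set.univ ν (fun _ => force S c) u p ∧ Function.Periodic u τ ∧
      meanEnergy u < E ∧ ε < meanDissipation ν u ∧ PeriodicPersistsAt S c ν τ u}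

/-- **Line glue, reshape v3 (curried)**: with the Malkin stub split as `malkinSteady ⊆ borderedSteady ⊆
closure (interior loud)` and the periodic stub as `nondegPeriodic ⊆ persistPeriodic ⊆ interior loud`, the eight
registered statements imply the crux (by `RobustLoudUpgrade_of`). [folklore] -/
theorem line_glue_v3 : (∀ (S : Finset (Fin 3 → ℤ)) (a E ε : ℝ), nondegSteady S a E ε ⊆ persistSteady S a E ε) → (∀ (S : Finset (Fin 3 → ℤ)) (a E ε : ℝ), persistSteady S a E ε ⊆ interior (loud S a E ε)) → (∀ (S : Finset (Fin 3 → ℤ)) (a E ε : ℝ), censusSteady S a E ε ⊆ interior (loud S a E ε)) → (∀ (S : Finset (Fin 3 → ℤ)) (a E ε : ℝ), malkinSteady S a E ε ⊆ borderedSteady S a E ε) → (∀ (S : Finset (Fin 3 → ℤ)) (a E ε : ℝ), borderedSteady S a E ε ⊆ closure (interior (loud S a E ε))) → (∀ (S : Finset (Fin 3 → ℤ)) (a E ε : ℝ), nondegPeriodic S a E ε ⊆ persistPeriodic S a E ε) → (∀ (S : Finset (Fin 3 → ℤ)) (a E ε : ℝ), persistPeriodic S a E ε ⊆ interior (loud S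 a E ε)) → (∀ S : Finset (Fin 3 → ℤ), unitStock ⊆ S → ∀ (a E ε : ℝ), 0 < a → 0 < ε → loud S a E ε ⊆ closure (tame S a (2 * E) (ε / 2))) → RobustLoudUpgrade :=
  fun h₁ h₁' h₀ h₂ h₂' h₃ h₃' h₅ => RobustLoudUpgrade_of h₁ h₁' h₀ (fun S a E ε => (h₂ S a E ε).trans (h₂' S a E ε))
    (fun S a E ε => (h₃ S a E ε).trans (h₃' S a E ε)) h₅

end Summit.AnomalousDissipation.AnomalousDissipation.Theorems.RobustLoudUpgrade
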